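import Mathlib
import Summits.KontsevichZagierPeriods.Zeta5Search.Elimination.DictStarTop
import Summits.KontsevichZagierPeriods.Zeta5Search.WedgeDictionaryFullQ
import HarnessLib

/-!
# The dictionary-side STAR relations at WIDE-region apexes (cell `pub-zeta5`, seat ct-1 g22)

HONEST FRAMING: systematic search; no irrationality claim unless certified.  Identities among the cell's rational dictionary data
(`QOf` = Brown–Zudilin's (17), `dictPhat`, `dictP`, the closed forms `U, W, V`, the gauge `ρ`) on the cell's own WIDE parameter region
`b(a) ≥ 0`, `d ≥ 0`; no cellular integral is evaluated, nothing about `ζ(5)`; no `def`, no new node.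

fam-elim's `Elimination.dictStar_top` proves gen-1's dictionary STAR relation `κ·v(a) − fan_k·v(a − s_k) + fan_i·v(a − s_i) = 0`
(`v = (Q, P̂_d, P_d)`) at every HALF-BOX apex (`RegionHyp` at the three points).  Its only half-box ingredient is the `Q`-row
`Q(y) = ρ(y)·(U∧W)(b(y))` of `PencilGauge.dict_values` (= `wedgeDictionary_Q`); the gauge-free STAR `DictStarTransport.star_wedge` and the
gauge law `PencilGauge.rhoB_lower` are box-wide.  With ct-1 g22's `WedgeDictionaryFullQ.wedgeDictionaryFull_Q` (`Q = ρ·(U∧W)` on the whole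
wide region) the same assembly gives the relation at every WIDE apex:

* `dict_values_wide` — `(Q, P̂_d, P_d)(y) = ρ(y)·(U∧W, U∧V, V∧W)(b(y))` for convergent `y` with `b(y) ≥ 0`, `d ≥ 0`, every partner;
* `dictStar_wide` — `DictThreeTerm (starKappa P i k) (−fanCoeff P k) (fanCoeff P i) a (a − s_k) (a − s_i) j₀ j₁ j₂` whenever the three points
  are convergent with non-negative dual slots and `d ≥ 0`, `P_i, P_k ≥ 1` and `P_k + 1 ≤ P₀` (`P = b(a)`).

This is the dictionary half of item (b) of `HOME/ct-1/g22/WIDE-RESIDUAL.md` (the blueprint for the open residual of `wedgeDictionaryFull`);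
the CELLULAR STAR at wide apexes (item (a)) is NOT proved here.
-/

noncomputable section

open Finset

namespace Summit.KontsevichZagierPeriods.Zeta5Search.WedgeDictionaryDictStarWide

open Summit.KontsevichZagierPeriods.Zeta5Search.Elimination
open Summit.KontsevichZagierPeriods.Zeta5Search.DualSeries (InBox)
open Summit.KontsevichZagierPeriods.Zeta5Search.WedgeDictionary
open Summit.KontsevichZagierPeriods.Zeta5Search.SymmetricGauge
open Summit.KontsevichZagierPeriods.Zeta5Search.WedgeDictionaryFullQ (wedgeDictionaryFull_Q)
open Literature.NumberTheory.Irrationality.BrownZudilin2022 (bOfA Converges QOf convergenceForms)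

/-- **Dictionary values on the wide region**: for convergent `y` with `b(y) ≥ 0`, `d ≥ 0` and any partner `j ∈ [1,7]`,
`Q(y) = ρ(y)·(U∧W)(b)`, `P̂_d(y) = ρ(y)·(U∧V)(b)`, `P_d(y) = ρ(y)·(V∧W)(b)` at `b = b(y)` (the `Q`-row is `wedgeDictionaryFull_Q`; the other two
rows are the partner-freeness of the wedges on the box). [folklore] -/
theorem dict_values_wide {y : Fin 8 → ℤ} {j : ℕ} (hj : j ∈ Icc 1 7) (hconv : Converges y)
    (hnn : ∀ i ∈ Icc 1 7, 0 ≤ bOfA y i) (hd : 0 ≤ dOf (bOfA y)) :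
    (QOf y : ℚ) = rhoOf y * casUW (bOfA y) ∧ dictPhat y j = rhoOf y * casUV (bOfA y) ∧
      dictP y j = rhoOf y * casVW (bOfA y) := by
  have hj' := mem_Icc.1 hj
  obtain ⟨hb, hle⟩ := inBox_of_full y hconv hnn
  have hjN : bOfA y j ≤ bOfA y 0 := hle j hj
  have h7N : bOfA y 7 ≤ bOfA y 0 := hle 7 (by simp)
  obtain ⟨fUW, fUV⟩ := wedge_slot_free (bOfA y) hb hd hj hjN h7N
  have hi : j - 1 ∈ range 7 := mem_range.2 (by omega)
  have hjj : j - 1 + 1 = j := by omega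
  have S := coeff_update_sub (bOfA y) hb hd hi (k := 6) (by simp) (by rw [hjj]; exact hjN) (by simpa using h7N)
  rw [hjj] at S
  obtain ⟨-, SW, SV⟩ := S
  have fVW : coeffV (bOfA y) * coeffW (Function.update (bOfA y) j (bOfA y j + 1)) -
      coeffV (Function.update (bOfA y) j (bOfA y j + 1)) * coeffW (bOfA y) = casVW (bOfA y) :=
    wedge_free coeffV coeffW (bOfA y) j (6 + 1) _ SV SW
  refine ⟨?_, ?_, ?_⟩
  · rw [wedgeDictionaryFull_Q hconv hnn hd hj, fUW]
  · unfold dictPhat; rw [fUV]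
  · unfold dictP; rw [← fVW]; ring

/-- **The dictionary STAR relation at every WIDE apex.**  For slots `i ≠ k` in `[1,7]`, partners `j₀, j₁, j₂ ∈ [1,7]`, and a point `a`
such that `a`, `a − s_k`, `a − s_i` are convergent with non-negative dual slots and `d ≥ 0`, with `P_i, P_k ≥ 1` and `P_k + 1 ≤ P₀`
(`P = b(a)`): `starKappa(P,i,k)·v(a) − fanCoeff(P,k)·v(a − s_k) + fanCoeff(P,i)·v(a − s_i) = 0` for the three dictionary coordinates
(`fam-elim`'s `dictStar_top` with the half box replaced by the wide region). [folklore] -/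
theorem dictStar_wide (a : Fin 8 → ℤ) (i k j₀ j₁ j₂ : ℕ) (hi : i ∈ Icc 1 7) (hk : k ∈ Icc 1 7) (hik : i ≠ k)
    (hj₀ : j₀ ∈ Icc 1 7) (hj₁ : j₁ ∈ Icc 1 7) (hj₂ : j₂ ∈ Icc 1 7)
    (hc₀ : Converges a) (hn₀ : ∀ m ∈ Icc 1 7, 0 ≤ bOfA a m) (hd₀ : 0 ≤ dOf (bOfA a))
    (hc₁ : Converges (a + slotDown k)) (hn₁ : ∀ m ∈ Icc 1 7, 0 ≤ bOfA (a + slotDown k) m) (hd₁ : 0 ≤ dOf (bOfA (a + slotDown k)))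
    (hc₂ : Converges (a + slotDown i)) (hn₂ : ∀ m ∈ Icc 1 7, 0 ≤ bOfA (a + slotDown i) m) (hd₂ : 0 ≤ dOf (bOfA (a + slotDown i)))
    (hkN : bOfA a k + 1 ≤ bOfA a 0) :
    DictThreeTerm (starKappa (bOfA a) i k) (-fanCoeff (bOfA a) k) (fanCoeff (bOfA a) i)
      a (a + slotDown k) (a + slotDown i) j₀ j₁ j₂ := by
  obtain ⟨hi1', hi7⟩ := mem_Icc.1 hi
  obtain ⟨hk1', hk7⟩ := mem_Icc.1 hk
  obtain ⟨hQ0, hPh0, hP0⟩ := dict_values_wide hj₀ hc₀ hn₀ hd₀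
  obtain ⟨hQ1, hPh1, hP1⟩ := dict_values_wide hj₁ hc₁ hn₁ hd₁
  obtain ⟨hQ2, hPh2, hP2⟩ := dict_values_wide hj₂ hc₂ hn₂ hd₂
  have hk1 : 1 ≤ bOfA a k := by
    have := hn₁ k hk
    rw [bOfA_add_slotDown a k hk k (by omega), if_pos rfl] at this
    omega
  have hi1 : 1 ≤ bOfA a i := by
    have := hn₂ i hi
    rw [bOfA_add_slotDown a i hi i (by omega), if_pos rfl] at this
    omega
  have hE : ∀ jk ∈ Epairs, bOfA a jk.1 + bOfA a jk.2 ≤ bOfA a 0 := epairs_le_of_converges a hc₀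
  obtain ⟨hPI, hle⟩ := inBox_of_full a hc₀ hn₀
  -- (1) the gauge-free STAR at `(P; i, k)`
  have W := star_wedge (bOfA a) hi hk hik hPI hd₀ hle hi1 hk1 hkN
  -- (2) the gauges of the two slot steps and (3) the polynomial identities
  obtain ⟨sk, rfl⟩ : ∃ s, k = s + 1 := ⟨k - 1, by omega⟩
  obtain ⟨si, rfl⟩ : ∃ s, i = s + 1 := ⟨i - 1, by omega⟩
  have Gk : rhoB (lowerAt (bOfA a) (sk + 1)) * ((dOf (bOfA a) : ℚ) + 1) * (chiOf (bOfA a) (sk + 1) : ℚ) =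
      -((bOfA a (sk + 1) : ℚ) * edgeProd (bOfA a) (sk + 1) * rhoB (bOfA a)) :=
    rhoB_lower (bOfA a) (show sk < 7 by omega) hPI hk1 hd₀ hE
  have Gi : rhoB (lowerAt (bOfA a) (si + 1)) * ((dOf (bOfA a) : ℚ) + 1) * (chiOf (bOfA a) (si + 1) : ℚ) =
      -((bOfA a (si + 1) : ℚ) * edgeProd (bOfA a) (si + 1) * rhoB (bOfA a)) :=
    rhoB_lower (bOfA a) (show si < 7 by omega) hPI hi1 hd₀ hE
  have Sk := starPi_gauge (bOfA a) hk
  have Si := starPi_gauge (bOfA a) hi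
  -- non-vanishing
  have hd : ((dOf (bOfA a) : ℚ) + 1) ≠ 0 := by
    have : (0 : ℚ) ≤ dOf (bOfA a) := by exact_mod_cast hd₀
    exact ne_of_gt (by linarith)
  have hχ : ∀ s, 1 ≤ bOfA a s → (chiOf (bOfA a) s : ℚ) ≠ 0 := fun s hs => by
    have : (1 : ℤ) ≤ chiOf (bOfA a) s := by
      unfold chiOf; split_ifs
      · omega
      · exact le_refl _
    have : (1 : ℚ) ≤ chiOf (bOfA a) s := by exact_mod_cast this
    exact ne_of_gt (by linarith)
  -- the two lowered points are `P − e_k`, `P − e_i`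
  have hQk : ∀ j, j ≤ 7 → bOfA (a + slotDown (sk + 1)) j = lowerAt (bOfA a) (sk + 1) j := fun j hj => by
    rw [bOfA_add_slotDown _ _ hk j hj, lowerAt_apply]
    split_ifs with h
    · rw [h]
    · rfl
  have hQi : ∀ j, j ≤ 7 → bOfA (a + slotDown (si + 1)) j = lowerAt (bOfA a) (si + 1) j := fun j hj => by
    rw [bOfA_add_slotDown _ _ hi j hj, lowerAt_apply]
    split_ifs with h
    · rw [h]
    · rfl
  rw [rhoOf_eq_rhoB] at hQ0 hPh0 hP0 hQ1 hPh1 hP1 hQ2 hPh2 hP2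
  rw [rhoB_congr hQk, (cas_congr hQk).1] at hQ1
  rw [rhoB_congr hQk, (cas_congr hQk).2.1] at hPh1
  rw [rhoB_congr hQk, (cas_congr hQk).2.2] at hP1
  rw [rhoB_congr hQi, (cas_congr hQi).1] at hQ2
  rw [rhoB_congr hQi, (cas_congr hQi).2.1] at hPh2
  rw [rhoB_congr hQi, (cas_congr hQi).2.2] at hP2
  unfold DictThreeTerm
  rw [hQ0, hPh0, hP0, hQ1, hPh1, hP1, hQ2, hPh2, hP2]
  exact ⟨starTop_assemble (W casUW (by simp)) Gk Gi Sk Si hd (hχ _ hk1) (hχ _ hi1),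
    starTop_assemble (W casUV (by simp)) Gk Gi Sk Si hd (hχ _ hk1) (hχ _ hi1),
    starTop_assemble (W casVW (by simp)) Gk Gi Sk Si hd (hχ _ hk1) (hχ _ hi1)⟩

end Summit.KontsevichZagierPeriods.Zeta5Search.WedgeDictionaryDictStarWide
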